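import Literature.Computability.AlgebraicComplexity.MS21ANFDerivativeStructure
import Literature.Computability.AlgebraicComplexity.MS21ANFOrbitsDistinctDepthProofs
import HarnessLib

/-!
# Medini–Shpilka 2021, §5.2: Lemma 5.13 (separating two ANF orbit elements by a second
# derivative) — the core, and the monomial structure of `ANF_Δ` it rests on

Theorem-only support file (cell `val-lit`, seat p1 g5; brick «Lemma 5.13-core» of the
`MS2021_thm_35` programme owned by seat x5 g3, route ruling 02:47Z 2026-08-27). Source:
[MediniShpilka2021] CCC 2021 = arXiv:2102.05632, §5.2, Lemma 5.13 (‹lem:separateRoanfSum›, held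
text p0029:L3–L13) with Obs 5.8 (‹obs:derivCroanf›, p0025:L57–L60) and ‹obs:monRoanf›.

Printed Lemma 5.13: "Let `f = ANF_Δ(A_1x)` and `g = ANF_Δ(A_2x)` … Denote `g̃ = g(A_1⁻¹x)`. If
`mon(g̃) ≠ mon(ANF_Δ(x))`, then there exist `v, u` such that `∂²f/∂v∂u = 0` and `∂²g/∂v∂u ≠ 0`."
Its proof: by lem:roanfMonInc (Lemma 5.12) `mon(g̃) ⊄ mon(ANF_Δ)`; fix `x^e ∈ mon(g̃) ∖ mon(ANF_Δ)`;
if `x_i² | x^e` take `v = u = v_i` (`ANF_Δ` is multilinear); if `x^e` is multilinear take `x_i, x_j`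
with an addition gate as first common gate. This file proves the CORE in the coordinates `y` of
`ANF_Δ` (the dual directions `v_i` of Lemma 3.8 turn `∂_{v_i}∂_{v_j} f` into `(∂_i∂_j ANF_Δ)(A_1 x)`;
that transport, and Lemma 5.12's `≠ ⇒ ⊄`, are the consortium's other bricks):

* `MS2021.exists_pderiv_pderiv_anf_eq_zero_and_ne_zero`: for ANY `P` homogeneous of degree `2^Δ`
  on the variables of `ANF_Δ` and a monomial `x^e ∈ mon(P) ∖ mon(ANF_Δ)`:
  `∃ i j, ∂_i∂_j ANF_Δ = 0 ∧ ∂_i∂_j P ≠ 0`, under the EXACT characteristic hypothesis the printed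
  case analysis needs (`hchar`: `x^e` multilinear, OR some `e_i ≥ 2` with `e_i(e_i-1) ≠ 0` in `K`);
  `…_of_cast_ne_zero` / `…_of_charZero` / `…_of_lt_ringChar` (`char K = 0` or `> 2^Δ`: every
  exponent `≤ deg = 2^Δ` is a unit) and the instance for `P = ANF_Δ(My)`
  (`MS2021.exists_pderiv_pderiv_anf_separates_linSubst`). CHARACTERISTIC RESIDUE (flagged, not
  hidden): in characteristic `p ≤ 2^Δ` the printed "if `x_i² | x^e` then clearly `∂²g/∂x_i² ≠ 0`"
  fails when every bad monomial is non-multilinear with all its exponents `a ≥ 2` satisfying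
  `p | a(a-1)` (`MS2021.coeff_pderiv_pderiv_self`: the coefficient is `e_i(e_i-1)·c_e`); the
  multilinear branch is characteristic-free.
* the structure facts this rests on, all from Def 8 by induction: second derivatives of `ANF_{Δ+1}`
  by block position (`MS2021.pderiv_pderiv_anf_succ_same/_sib/_other`, from seat x5's Obs 5.8
  `pderiv_anf_succ`); **obs:monRoanf in kernel form** (`MS2021.card_le_and_coeff_anf_ne_zero_of_compatible`):
  a set of variables any two of which have a MULTIPLICATION gate as first common gate (⇔ nonzero
  mixed second derivative) has `≤ 2^Δ` elements, and with exactly `2^Δ` elements its product is a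
  monomial of `ANF_Δ` (coefficient `≠ 0`); `MS2021.pderiv_pderiv_self_eq_zero_of_degreeOf_le_one`
  (multilinear ⇒ pure second derivatives vanish), coefficient formulas
  `MS2021.coeff_pderiv_pderiv_mixed/_self`.

No definitions, no facts. HONEST FRAMING: a structural lemma of a 2021 paper, kernel-checked as
infrastructure for a literature discharge; `VP ≠ VNP` is NOT proved and nothing here bears on it.

## References
* [MediniShpilka2021] D. Medini, A. Shpilka, CCC 2021 (LIPIcs 200:19) = arXiv:2102.05632: Def 8 /
  Def 5.4 (ANF), Obs 5.8, Cor 5.10, obs:monRoanf (p0025:L31-L70, p0026), Lemma 5.12 (p0027:L40),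
  Lemma 5.13 and proof (p0029:L3-L13), Lemma 3.8 (p0017:L60-L66).
* Tree: seat x5 g3's `MS21ANFDerivativeStructure.lean` (`pderiv_anf_succ`, `degreeOf_anf_le_one`,
  `pderiv_anf_ne_zero`) and `MS21ANFOrbitsDistinctDepthProofs.lean` (`isHomogeneous_anf`,
  `anf_ne_zero`, `exists_eq_anfBlock`, `anfBlock_injective`); seat x6 g2's `anfBlock_inj`.
-/

noncomputable section

open MvPolynomial

namespace Literature.Computability.AlgebraicComplexity

namespace MS2021

/-! ### Coefficients of second partial derivatives -/

section SecondDerivatives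

variable {K : Type*} [Field K] {σ : Type*}

/-- `coeff m (∂_i ∂_j P) = coeff (m + e_i + e_j) P · ((m + e_i)_j + 1) · (m_i + 1)`. [folklore] -/
private theorem coeff_pderiv_pderiv (i j : σ) (P : MvPolynomial σ K) (m : σ →₀ ℕ) :
    coeff m (pderiv i (pderiv j P)) =
      coeff (m + Finsupp.single i 1 + Finsupp.single j 1) P *
        ((((m + Finsupp.single i 1 : σ →₀ ℕ) j : ℕ) : K) + 1) * (((m i : ℕ) : K) + 1) := by
  rw [coeff_pderiv, coeff_pderiv]

/-- A multilinear polynomial has vanishing pure second derivatives ("`∂²ANF/∂x_i² = 0`, as `ANF` is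
multilinear"). [cite: MediniShpilka2021, proof of Lemma 5.13 (arXiv p0029:L11)] -/
theorem pderiv_pderiv_self_eq_zero_of_degreeOf_le_one [DecidableEq σ] (i : σ)
    {f : MvPolynomial σ K} (hf : degreeOf i f ≤ 1) : pderiv i (pderiv i f) = 0 := by
  classical
  ext m
  rw [coeff_pderiv_pderiv, coeff_zero]
  have hnot : m + Finsupp.single i 1 + Finsupp.single i 1 ∉ f.support := by
    intro h
    have := monomial_le_degreeOf i h
    simp only [Finsupp.coe_add, Pi.add_apply, Finsupp.single_eq_same] at this
    omega
  rw [notMem_support_iff.1 hnot, zero_mul, zero_mul]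

/-- The coefficient of `x^{e - e_i - e_j}` in `∂_i ∂_j P` for `i ≠ j`, `e_i, e_j ≥ 1`:
`e_i · e_j · coeff e P` — "clearly `∂²g/∂v∂u ≠ 0`". [cite: MediniShpilka2021, proof of Lemma 5.13 (arXiv p0029:L11-L13)] -/
theorem coeff_pderiv_pderiv_mixed [DecidableEq σ] {i j : σ} (hij : i ≠ j) (P : MvPolynomial σ K)
    {e : σ →₀ ℕ} (hi : 1 ≤ e i) (hj : 1 ≤ e j) :
    coeff (e - Finsupp.single i 1 - Finsupp.single j 1) (pderiv i (pderiv j P)) =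
      (e i : K) * (e j : K) * coeff e P := by
  rw [coeff_pderiv_pderiv]
  have h1 : e - Finsupp.single i 1 - Finsupp.single j 1 + Finsupp.single i 1 + Finsupp.single j 1 = e := by
    ext x
    simp only [Finsupp.coe_add, Finsupp.coe_tsub, Pi.add_apply, Pi.sub_apply, Finsupp.single_apply]
    by_cases hx : i = x
    · subst hx
      rw [if_neg (Ne.symm hij)]
      simp only [if_true]
      omega
    · by_cases hx' : j = x
      · subst hx'
        simp only [if_neg hx, if_true]
        omega
      · simp only [if_neg hx, if_neg hx']
        omega
  have h2 : ((e - Finsupp.single i 1 - Finsupp.single j 1 + Finsupp.single i 1 : σ →₀ ℕ) j : ℕ) + 1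
      = e j := by
    simp only [Finsupp.coe_add, Finsupp.coe_tsub, Pi.add_apply, Pi.sub_apply, Finsupp.single_apply,
      if_neg hij]
    simp only [if_true]
    omega
  have h3 : ((e - Finsupp.single i 1 - Finsupp.single j 1 : σ →₀ ℕ) i : ℕ) + 1 = e i := by
    simp only [Finsupp.coe_tsub, Pi.sub_apply, Finsupp.single_apply, if_neg (Ne.symm hij)]
    simp only [if_true]
    omega
  rw [h1]
  have h2' : ((((e - Finsupp.single i 1 - Finsupp.single j 1 + Finsupp.single i 1 : σ →₀ ℕ) j : ℕ) : K)
      + 1) = (e j : K) := by rw [← Nat.cast_succ, Nat.succ_eq_add_one, h2]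
  have h3' : ((((e - Finsupp.single i 1 - Finsupp.single j 1 : σ →₀ ℕ) i : ℕ) : K) + 1) = (e i : K) := by
    rw [← Nat.cast_succ, Nat.succ_eq_add_one, h3]
  rw [h2', h3']
  ring

/-- The coefficient of `x^{e - 2e_i}` in `∂_i² P` for `e_i ≥ 2`: `e_i (e_i - 1) · coeff e P` — the
characteristic-SENSITIVE spot of the printed "if `x_i² | x^e` then clearly `∂²g/∂x_i² ≠ 0`".
[cite: MediniShpilka2021, proof of Lemma 5.13 (arXiv p0029:L11)] -/
theorem coeff_pderiv_pderiv_self (i : σ) (P : MvPolynomial σ K) {e : σ →₀ ℕ} (hi : 2 ≤ e i) :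
    coeff (e - Finsupp.single i 2) (pderiv i (pderiv i P)) =
      (e i : K) * ((e i - 1 : ℕ) : K) * coeff e P := by
  classical
  rw [coeff_pderiv_pderiv]
  have h1 : e - Finsupp.single i 2 + Finsupp.single i 1 + Finsupp.single i 1 = e := by
    ext x
    simp only [Finsupp.coe_add, Finsupp.coe_tsub, Pi.add_apply, Pi.sub_apply, Finsupp.single_apply]
    by_cases hx : i = x
    · subst hx
      simp only [if_true]
      omega
    · simp only [if_neg hx]
      omega
  have h2 : ((e - Finsupp.single i 2 + Finsupp.single i 1 : σ →₀ ℕ) i : ℕ) + 1 = e i := by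
    simp only [Finsupp.coe_add, Finsupp.coe_tsub, Pi.add_apply, Pi.sub_apply, Finsupp.single_eq_same]
    omega
  have h3 : ((e - Finsupp.single i 2 : σ →₀ ℕ) i : ℕ) + 1 = e i - 1 := by
    simp only [Finsupp.coe_tsub, Pi.sub_apply, Finsupp.single_eq_same]
    omega
  rw [h1]
  have h2' : ((((e - Finsupp.single i 2 + Finsupp.single i 1 : σ →₀ ℕ) i : ℕ) : K) + 1) = (e i : K) := by
    rw [← Nat.cast_succ, Nat.succ_eq_add_one, h2]
  have h3' : ((((e - Finsupp.single i 2 : σ →₀ ℕ) i : ℕ) : K) + 1) = ((e i - 1 : ℕ) : K) := by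
    rw [← Nat.cast_succ, Nat.succ_eq_add_one, h3]
  rw [h2', h3']
  ring

end SecondDerivatives

/-! ### Second derivatives of `ANF_{Δ+1}` by block position (from Obs 5.8) -/

section ANFSecond

variable (K : Type*) [Field K]

/-- Same block: `∂_{x^{(b)}_j} ∂_{x^{(b)}_{j'}} ANF_{Δ+1} = ANF_Δ(x^{(sib b)}) · (∂_j∂_{j'}ANF_Δ)(x^{(b)})`.
[cite: MediniShpilka2021, Obs 5.8 (arXiv p0025:L57-L60)] -/
theorem pderiv_pderiv_anf_succ_same (Δ : ℕ) (b : Fin 4) (j j' : Fin (4 ^ Δ)) :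
    pderiv (anfBlock Δ b j') (pderiv (anfBlock Δ b j) (anf K (Δ + 1))) =
      rename (anfBlock Δ (1 - b)) (anf K Δ) *
        rename (anfBlock Δ b) (pderiv j' (pderiv j (anf K Δ))) := by
  have hsib : (1 - b : Fin 4) ≠ b := by fin_cases b <;> decide
  rw [pderiv_anf_succ, Derivation.leibniz, smul_eq_mul, smul_eq_mul,
    pderiv_anfBlock_rename_self, pderiv_anfBlock_rename_of_ne K hsib, mul_zero, add_zero]

/-- Sibling blocks: `∂_{x^{(b)}_j} ∂_{x^{(sib b)}_{j'}} ANF_{Δ+1} = (∂_{j'}ANF_Δ)(x^{(sib b)}) · (∂_j ANF_Δ)(x^{(b)}) ≠ 0`.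
[cite: MediniShpilka2021, Obs 5.8 (arXiv p0025:L57-L60)] -/
theorem pderiv_pderiv_anf_succ_sib (Δ : ℕ) (b : Fin 4) (j j' : Fin (4 ^ Δ)) :
    pderiv (anfBlock Δ (1 - b) j') (pderiv (anfBlock Δ b j) (anf K (Δ + 1))) =
      rename (anfBlock Δ (1 - b)) (pderiv j' (anf K Δ)) *
        rename (anfBlock Δ b) (pderiv j (anf K Δ)) := by
  have hsib : (1 - b : Fin 4) ≠ b := by fin_cases b <;> decide
  rw [pderiv_anf_succ, Derivation.leibniz, smul_eq_mul, smul_eq_mul,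
    pderiv_anfBlock_rename_of_ne K hsib.symm, pderiv_anfBlock_rename_self, mul_zero, zero_add,
    mul_comm]

/-- Across the top addition gate: for `b' ∉ {b, sib b}`,
`∂_{x^{(b)}_j} ∂_{x^{(b')}_{j'}} ANF_{Δ+1} = 0` ("`fcg(x_i, x_j)` is an addition gate").
[cite: MediniShpilka2021, Obs 5.8 and proof of Lemma 5.13 (arXiv p0025:L57-L60, p0029:L13)] -/
theorem pderiv_pderiv_anf_succ_other (Δ : ℕ) {b b' : Fin 4} (hb : b' ≠ b) (hb' : b' ≠ 1 - b)
    (j j' : Fin (4 ^ Δ)) :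
    pderiv (anfBlock Δ b' j') (pderiv (anfBlock Δ b j) (anf K (Δ + 1))) = 0 := by
  rw [pderiv_anf_succ, Derivation.leibniz, smul_eq_mul, smul_eq_mul,
    pderiv_anfBlock_rename_of_ne K hb.symm, pderiv_anfBlock_rename_of_ne K hb'.symm, mul_zero,
    mul_zero, add_zero]

/-- Same block, non-vanishing transfers down: `∂∂ ANF_{Δ+1} ≠ 0 ↔ ∂∂ ANF_Δ ≠ 0`.
[cite: MediniShpilka2021, Obs 5.8 (arXiv p0025:L57-L60)] -/
theorem pderiv_pderiv_anf_succ_same_ne_zero_iff (Δ : ℕ) (b : Fin 4) (j j' : Fin (4 ^ Δ)) :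
    pderiv (anfBlock Δ b j') (pderiv (anfBlock Δ b j) (anf K (Δ + 1))) ≠ 0 ↔
      pderiv j' (pderiv j (anf K Δ)) ≠ 0 := by
  rw [pderiv_pderiv_anf_succ_same, mul_ne_zero_iff]
  have h1 : rename (anfBlock Δ (1 - b)) (anf K Δ) ≠ 0 :=
    (map_ne_zero_iff _ (rename_injective _ (anfBlock_injective Δ _))).2 (anf_ne_zero K Δ)
  have hinj := rename_injective (R := K) _ (anfBlock_injective Δ b)
  constructor
  · rintro ⟨-, h⟩
    exact (map_ne_zero_iff _ hinj).1 h
  · intro h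
    exact ⟨h1, (map_ne_zero_iff _ hinj).2 h⟩

/-- Sibling blocks are always compatible: the mixed derivative is a product of nonzero
polynomials. [cite: MediniShpilka2021, Obs 5.8, Cor 5.10 (arXiv p0025:L57-L70)] -/
theorem pderiv_pderiv_anf_succ_sib_ne_zero (Δ : ℕ) (b : Fin 4) (j j' : Fin (4 ^ Δ)) :
    pderiv (anfBlock Δ (1 - b) j') (pderiv (anfBlock Δ b j) (anf K (Δ + 1))) ≠ 0 := by
  rw [pderiv_pderiv_anf_succ_sib]
  exact mul_ne_zero
    ((map_ne_zero_iff _ (rename_injective _ (anfBlock_injective Δ _))).2 (pderiv_anf_ne_zero K Δ j'))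
    ((map_ne_zero_iff _ (rename_injective _ (anfBlock_injective Δ _))).2 (pderiv_anf_ne_zero K Δ j))

end ANFSecond

/-! ### Monomials of `ANF_Δ`: pairwise compatible variable sets (obs:monRoanf in kernel form) -/

section Compatibility

variable (K : Type*) [Field K]

/-- The indicator exponent of a finite set of variables. [folklore] -/
private theorem sum_single_apply {σ : Type*} [DecidableEq σ] (S : Finset σ) (x : σ) :
    (∑ i ∈ S, Finsupp.single i 1 : σ →₀ ℕ) x = if x ∈ S then 1 else 0 := by
  rw [Finsupp.finsetSum_apply]
  simp_rw [Finsupp.single_apply]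
  rw [Finset.sum_ite_eq']

/-- Coefficient of a split exponent in a product of polynomials living on DISJOINT renamed variable
sets: it factors. [folklore] -/
private theorem coeff_rename_mul_rename {σ τ : Type*} [DecidableEq τ] (f g : σ → τ)
    (hf : Function.Injective f) (hg : Function.Injective g) (hfg : ∀ a b, f a ≠ g b)
    (p q : MvPolynomial σ K) (α β : σ →₀ ℕ) :
    coeff (Finsupp.mapDomain f α + Finsupp.mapDomain g β) (rename f p * rename g q) =
      coeff α p * coeff β q := by
  classical
  rw [coeff_mul, Finset.sum_eq_single (Finsupp.mapDomain f α, Finsupp.mapDomain g β)]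
  · rw [coeff_rename_mapDomain f hf, coeff_rename_mapDomain g hg]
  · rintro ⟨y₁, y₂⟩ hy hne
    rw [Finset.HasAntidiagonal.mem_antidiagonal] at hy
    by_contra hprod
    have h1 : coeff y₁ (rename f p) ≠ 0 := left_ne_zero_of_mul hprod
    have h2 : coeff y₂ (rename g q) ≠ 0 := right_ne_zero_of_mul hprod
    obtain ⟨u, hu, -⟩ : ∃ u, Finsupp.mapDomain f u = y₁ ∧ coeff u p ≠ 0 := by
      by_contra hcon
      push Not at hcon
      exact h1 (coeff_rename_eq_zero f p y₁ hcon)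
    obtain ⟨v, hv, -⟩ : ∃ v, Finsupp.mapDomain g v = y₂ ∧ coeff v q ≠ 0 := by
      by_contra hcon
      push Not at hcon
      exact h2 (coeff_rename_eq_zero g q y₂ hcon)
    subst hu hv
    apply hne
    have hfa : ∀ a, f a ∉ Set.range g := fun a ⟨b, hb⟩ => hfg a b hb.symm
    have hga : ∀ b, g b ∉ Set.range f := fun b ⟨a, ha⟩ => hfg a b ha
    have huα : u = α := by
      ext a
      have := congr_arg (fun w : τ →₀ ℕ => w (f a)) hy
      simp only [Finsupp.coe_add, Pi.add_apply, Finsupp.mapDomain_apply hf,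
        Finsupp.mapDomain_notin_range _ _ (hfa a), add_zero] at this
      exact this
    have hvβ : v = β := by
      ext b
      have := congr_arg (fun w : τ →₀ ℕ => w (g b)) hy
      simp only [Finsupp.coe_add, Pi.add_apply, Finsupp.mapDomain_apply hg,
        Finsupp.mapDomain_notin_range _ _ (hga b), zero_add] at this
      exact this
    rw [huα, hvβ]
  · intro hnot
    exfalso
    apply hnot
    simp only [Finset.HasAntidiagonal.mem_antidiagonal]

/-- A product of polynomials on the variable sets `range f ∪ range g` has no monomial touching a
variable outside. [folklore] -/
private theorem coeff_rename_mul_rename_eq_zero {σ τ : Type*} [DecidableEq τ] (f g : σ → τ)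
    (p q : MvPolynomial σ K) (n : τ →₀ ℕ) (x : τ) (hx : n x ≠ 0) (hxf : ∀ a, f a ≠ x)
    (hxg : ∀ b, g b ≠ x) : coeff n (rename f p * rename g q) = 0 := by
  classical
  rw [coeff_mul]
  refine Finset.sum_eq_zero fun y hy => ?_
  rw [Finset.HasAntidiagonal.mem_antidiagonal] at hy
  by_contra hprod
  obtain ⟨u, hu, -⟩ : ∃ u, Finsupp.mapDomain f u = y.1 ∧ coeff u p ≠ 0 := by
    by_contra hcon
    push Not at hcon
    exact (left_ne_zero_of_mul hprod) (coeff_rename_eq_zero f p y.1 hcon)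
  obtain ⟨v, hv, -⟩ : ∃ v, Finsupp.mapDomain g v = y.2 ∧ coeff v q ≠ 0 := by
    by_contra hcon
    push Not at hcon
    exact (right_ne_zero_of_mul hprod) (coeff_rename_eq_zero g q y.2 hcon)
  apply hx
  rw [← hy, ← hu, ← hv, Finsupp.coe_add, Pi.add_apply,
    Finsupp.mapDomain_notin_range _ _ (fun ⟨a, ha⟩ => hxf a ha),
    Finsupp.mapDomain_notin_range _ _ (fun ⟨b, hb⟩ => hxg b hb), add_zero]

/-- Two variables of `ANF_{Δ+1}` in blocks lying across the top addition gate are incompatible;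
hence a pairwise compatible set meets only one side `{b, sib b}`. [cite: MediniShpilka2021, Obs 5.8 / proof of Lemma 5.13 (arXiv p0025:L57-L60, p0029:L13)] -/
theorem block_eq_or_eq_sib_of_compatible {Δ : ℕ} {S : Finset (Fin (4 ^ (Δ + 1)))}
    (hS : ∀ i ∈ S, ∀ j ∈ S, i ≠ j → pderiv i (pderiv j (anf K (Δ + 1))) ≠ 0)
    {b b' : Fin 4} {j j' : Fin (4 ^ Δ)} (hx : anfBlock Δ b j ∈ S) (hx' : anfBlock Δ b' j' ∈ S) :
    b' = b ∨ b' = 1 - b := by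
  by_contra hcon
  push Not at hcon
  have hne : anfBlock Δ b' j' ≠ anfBlock Δ b j := fun h => hcon.1 (anfBlock_inj h).1
  exact hS _ hx' _ hx hne (pderiv_pderiv_anf_succ_other K Δ hcon.1 hcon.2 j j')

/-- One induction step of the compatibility lemma, for a fixed sibling pair `(c, c')` carrying the
set. [cite: MediniShpilka2021, Obs 5.8, obs:monRoanf (arXiv p0025:L57-L60, p0026)] -/
private theorem compatible_step {Δ : ℕ}
    (IH : ∀ T : Finset (Fin (4 ^ Δ)), (∀ i ∈ T, ∀ j ∈ T, i ≠ j → pderiv i (pderiv j (anf K Δ)) ≠ 0) →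
      T.card ≤ 2 ^ Δ ∧ (T.card = 2 ^ Δ → coeff (∑ i ∈ T, Finsupp.single i 1) (anf K Δ) ≠ 0))
    (c c' d d' : Fin 4) (hcc : c ≠ c') (hd : d ≠ c) (hd2 : d ≠ c') (hd' : d' ≠ c) (hd'2 : d' ≠ c')
    (heq : anf K (Δ + 1) = rename (anfBlock Δ c) (anf K Δ) * rename (anfBlock Δ c') (anf K Δ) +
      rename (anfBlock Δ d) (anf K Δ) * rename (anfBlock Δ d') (anf K Δ))
    (S : Finset (Fin (4 ^ (Δ + 1))))
    (hS : ∀ i ∈ S, ∀ j ∈ S, i ≠ j → pderiv i (pderiv j (anf K (Δ + 1))) ≠ 0)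
    (hsub : ∀ x ∈ S, ∃ j, x = anfBlock Δ c j ∨ x = anfBlock Δ c' j) :
    S.card ≤ 2 ^ (Δ + 1) ∧
      (S.card = 2 ^ (Δ + 1) → coeff (∑ i ∈ S, Finsupp.single i 1) (anf K (Δ + 1)) ≠ 0) := by
  classical
  -- the two block parts
  set T : Finset (Fin (4 ^ Δ)) := Finset.univ.filter fun j => anfBlock Δ c j ∈ S with hT
  set T' : Finset (Fin (4 ^ Δ)) := Finset.univ.filter fun j => anfBlock Δ c' j ∈ S with hT'
  have hcompat : ∀ (b : Fin 4) (U : Finset (Fin (4 ^ Δ))), (∀ j, j ∈ U ↔ anfBlock Δ b j ∈ S) →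
      ∀ i ∈ U, ∀ j ∈ U, i ≠ j → pderiv i (pderiv j (anf K Δ)) ≠ 0 := by
    intro b U hU i hi j hj hij
    have h := hS _ ((hU i).1 hi) _ ((hU j).1 hj) (fun h => hij (anfBlock_inj h).2)
    exact (pderiv_pderiv_anf_succ_same_ne_zero_iff K Δ b j i).1 h
  have hTiff : ∀ j, j ∈ T ↔ anfBlock Δ c j ∈ S := fun j => by simp [hT]
  have hT'iff : ∀ j, j ∈ T' ↔ anfBlock Δ c' j ∈ S := fun j => by simp [hT']
  obtain ⟨hTle, hTeq⟩ := IH T (hcompat c T hTiff)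
  obtain ⟨hT'le, hT'eq⟩ := IH T' (hcompat c' T' hT'iff)
  -- `S` is the disjoint union of the two embedded parts
  have hSeq : S = T.map ⟨anfBlock Δ c, anfBlock_injective Δ c⟩ ∪
      T'.map ⟨anfBlock Δ c', anfBlock_injective Δ c'⟩ := by
    ext x
    simp only [Finset.mem_union, Finset.mem_map, Function.Embedding.coeFn_mk, hTiff, hT'iff]
    constructor
    · intro hx
      obtain ⟨j, rfl | rfl⟩ := hsub x hx
      · exact Or.inl ⟨j, hx, rfl⟩
      · exact Or.inr ⟨j, hx, rfl⟩
    · rintro (⟨j, hj, rfl⟩ | ⟨j, hj, rfl⟩) <;> assumption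
  have hdisj : Disjoint (T.map ⟨anfBlock Δ c, anfBlock_injective Δ c⟩)
      (T'.map ⟨anfBlock Δ c', anfBlock_injective Δ c'⟩) := by
    rw [Finset.disjoint_left]
    intro x hx hx'
    obtain ⟨j, -, rfl⟩ := Finset.mem_map.1 hx
    obtain ⟨j', -, hjj'⟩ := Finset.mem_map.1 hx'
    exact hcc (anfBlock_inj hjj').1.symm
  have hcard : S.card = T.card + T'.card := by
    rw [hSeq, Finset.card_union_of_disjoint hdisj, Finset.card_map, Finset.card_map]
  have hpow : 2 ^ (Δ + 1) = 2 ^ Δ + 2 ^ Δ := by ring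
  refine ⟨by omega, fun hfull => ?_⟩
  have hTc : T.card = 2 ^ Δ := by omega
  have hT'c : T'.card = 2 ^ Δ := by omega
  -- the indicator exponent splits along the two blocks
  have hind : (∑ i ∈ S, Finsupp.single i 1 : Fin (4 ^ (Δ + 1)) →₀ ℕ) =
      Finsupp.mapDomain (anfBlock Δ c) (∑ i ∈ T, Finsupp.single i 1) +
        Finsupp.mapDomain (anfBlock Δ c') (∑ i ∈ T', Finsupp.single i 1) := by
    ext x
    rw [sum_single_apply, Finsupp.coe_add, Pi.add_apply]
    obtain ⟨b, j, rfl⟩ := exists_eq_anfBlock Δ x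
    by_cases hbc : b = c
    · subst hbc
      rw [Finsupp.mapDomain_apply (anfBlock_injective Δ b), sum_single_apply,
        Finsupp.mapDomain_notin_range, add_zero]
      · exact if_congr (hTiff j).symm rfl rfl
      · rintro ⟨j', h⟩
        exact hcc (anfBlock_inj h).1.symm
    · by_cases hbc' : b = c'
      · subst hbc'
        rw [Finsupp.mapDomain_apply (anfBlock_injective Δ b), sum_single_apply,
          Finsupp.mapDomain_notin_range, zero_add]
        · exact if_congr (hT'iff j).symm rfl rfl
        · rintro ⟨j', h⟩
          exact hbc (anfBlock_inj h).1.symm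
      · rw [Finsupp.mapDomain_notin_range, Finsupp.mapDomain_notin_range, add_zero, if_neg]
        · intro hx
          obtain ⟨j', h | h⟩ := hsub _ hx
          · exact hbc (anfBlock_inj h).1
          · exact hbc' (anfBlock_inj h).1
        · rintro ⟨j', h⟩
          exact hbc' (anfBlock_inj h).1.symm
        · rintro ⟨j', h⟩
          exact hbc (anfBlock_inj h).1.symm
  -- some variable of `S`, to see that the other product contributes nothing
  have hSne : S.Nonempty := by
    rw [← Finset.card_pos, hfull]
    positivity
  obtain ⟨x₀, hx₀⟩ := hSne
  have hx₀ind : (∑ i ∈ S, Finsupp.single i 1 : Fin (4 ^ (Δ + 1)) →₀ ℕ) x₀ ≠ 0 := by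
    rw [sum_single_apply, if_pos hx₀]
    exact one_ne_zero
  have hx₀d : ∀ a, anfBlock Δ d a ≠ x₀ := by
    intro a h
    obtain ⟨j, hj | hj⟩ := hsub x₀ hx₀
    · exact hd (anfBlock_inj (h.trans hj)).1
    · exact hd2 (anfBlock_inj (h.trans hj)).1
  have hx₀d' : ∀ a, anfBlock Δ d' a ≠ x₀ := by
    intro a h
    obtain ⟨j, hj | hj⟩ := hsub x₀ hx₀
    · exact hd' (anfBlock_inj (h.trans hj)).1
    · exact hd'2 (anfBlock_inj (h.trans hj)).1
  rw [heq, coeff_add, coeff_rename_mul_rename_eq_zero K _ _ _ _ _ x₀ hx₀ind hx₀d hx₀d', add_zero,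
    hind, coeff_rename_mul_rename K _ _ (anfBlock_injective Δ c) (anfBlock_injective Δ c')
      (fun a b h => hcc (anfBlock_inj h).1)]
  exact mul_ne_zero (hTeq hTc) (hT'eq hT'c)

/-- **The monomials of `ANF_Δ` (obs:monRoanf), kernel form.** A set `S` of variables that is
PAIRWISE COMPATIBLE — every two distinct `x_i, x_j ∈ S` have `∂_i∂_j ANF_Δ ≠ 0`, i.e. their first
common gate is a multiplication gate — has at most `2^Δ` elements, and if it has exactly `2^Δ` then
`∏_{i ∈ S} x_i` is a monomial of `ANF_Δ`. (Induction along Def 8: across the top addition gate two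
variables are incompatible, so `S` lives in one sibling pair of blocks, where it splits.)
[cite: MediniShpilka2021, Obs 5.8 and obs:monRoanf, proof of Lemma 5.13 (arXiv p0025:L57-L60, p0029:L11-L13)] -/
theorem card_le_and_coeff_anf_ne_zero_of_compatible : ∀ (Δ : ℕ) (S : Finset (Fin (4 ^ Δ))),
    (∀ i ∈ S, ∀ j ∈ S, i ≠ j → pderiv i (pderiv j (anf K Δ)) ≠ 0) →
      S.card ≤ 2 ^ Δ ∧ (S.card = 2 ^ Δ → coeff (∑ i ∈ S, Finsupp.single i 1) (anf K Δ) ≠ 0)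
  | 0, S, _ => by
    classical
    have hcard : S.card ≤ 1 := by
      have := Finset.card_le_univ S
      simpa using this
    refine ⟨by simpa using hcard, fun hS1 => ?_⟩
    have huniv : S = Finset.univ := Finset.eq_univ_of_card S (by simpa using hS1)
    subst huniv
    have hu : (Finset.univ : Finset (Fin (4 ^ 0))) = {⟨0, by norm_num⟩} := by
      ext x
      simp only [Finset.mem_univ, Finset.mem_singleton, true_iff]
      ext; have := x.2; simp only [pow_zero] at this; simp only; omega
    rw [hu, Finset.sum_singleton]
    simp [anf, coeff_X]
  | Δ + 1, S, hS => by
    classical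
    by_cases hSe : S = ∅
    · subst hSe
      refine ⟨by simp, fun h => ?_⟩
      rw [Finset.card_empty] at h
      exact absurd h (by positivity)
    obtain ⟨x₀, hx₀⟩ := Finset.nonempty_iff_ne_empty.2 hSe
    obtain ⟨b₀, j₀, rfl⟩ := exists_eq_anfBlock Δ x₀
    have IH := card_le_and_coeff_anf_ne_zero_of_compatible Δ
    have hsub : ∀ x ∈ S, ∃ j, x = anfBlock Δ b₀ j ∨ x = anfBlock Δ (1 - b₀) j := by
      intro x hx
      obtain ⟨b, j, rfl⟩ := exists_eq_anfBlock Δ x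
      rcases block_eq_or_eq_sib_of_compatible K hS hx₀ hx with h | h
      · exact ⟨j, Or.inl (by rw [h])⟩
      · exact ⟨j, Or.inr (by rw [h])⟩
    have h01 : anf K (Δ + 1) = rename (anfBlock Δ 0) (anf K Δ) * rename (anfBlock Δ 1) (anf K Δ) +
        rename (anfBlock Δ 2) (anf K Δ) * rename (anfBlock Δ 3) (anf K Δ) := anf_succ K Δ
    fin_cases b₀
    · exact compatible_step K IH 0 1 2 3 (by decide) (by decide) (by decide) (by decide) (by decide)
        h01 S hS hsub
    · exact compatible_step K IH 1 0 2 3 (by decide) (by decide) (by decide) (by decide) (by decide)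
        (by rw [h01]; ring) S hS hsub
    · exact compatible_step K IH 2 3 0 1 (by decide) (by decide) (by decide) (by decide) (by decide)
        (by rw [h01]; ring) S hS hsub
    · exact compatible_step K IH 3 2 0 1 (by decide) (by decide) (by decide) (by decide) (by decide)
        (by rw [h01]; ring) S hS hsub

end Compatibility

/-! ### Lemma 5.13, the separation core -/

section Separation

variable (K : Type*) [Field K]

/-- A multilinear exponent is the indicator of its support. [folklore] -/
private theorem eq_sum_single_of_le_one {σ : Type*} [DecidableEq σ] (e : σ →₀ ℕ)
    (he : ∀ i, e i ≤ 1) : e = ∑ i ∈ e.support, Finsupp.single i 1 := by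
  ext x
  rw [sum_single_apply]
  by_cases hx : x ∈ e.support
  · rw [if_pos hx]
    have h1 := he x
    have h2 := Finsupp.mem_support_iff.1 hx
    omega
  · rw [if_neg hx]
    exact Finsupp.notMem_support_iff.1 hx

/-- **MS Lemma 5.13, core (separation by a second derivative).** Let `P` be homogeneous of degree
`2^Δ` on the `4^Δ` variables of `ANF_Δ` (e.g. `P = ANF_Δ(My)`), and let `x^e` be a monomial of `P`
that is NOT a monomial of `ANF_Δ` (the conclusion of lem:roanfMonInc). Then some second derivative
kills `ANF_Δ` but not `P`: `∂_i∂_j ANF_Δ = 0 ≠ ∂_i∂_j P`. The two printed cases: `x^e` not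
multilinear — take `i = j` with `x_i² | x^e` (multilinearity of `ANF_Δ`; this needs
`e_i(e_i - 1) ≠ 0` IN THE FIELD, the hypothesis `hchar`, automatic in characteristic `0` or
`> 2^Δ`); `x^e` multilinear — some pair of its variables has an addition gate as first common gate
(else, by `card_le_and_coeff_anf_ne_zero_of_compatible`, `x^e` would be a monomial of `ANF_Δ`),
characteristic-free. [cite: MediniShpilka2021, Lemma 5.13 and its proof (arXiv p0029:L3-L13)] -/
theorem exists_pderiv_pderiv_anf_eq_zero_and_ne_zero (Δ : ℕ) {P : MvPolynomial (Fin (4 ^ Δ)) K}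
    (hP : P.IsHomogeneous (2 ^ Δ)) {e : Fin (4 ^ Δ) →₀ ℕ} (he : e ∈ P.support)
    (hne : e ∉ (anf K Δ).support)
    (hchar : (∀ i, e i ≤ 1) ∨ ∃ i, 2 ≤ e i ∧ ((e i : K) * ((e i - 1 : ℕ) : K)) ≠ 0) :
    ∃ i j, pderiv i (pderiv j (anf K Δ)) = 0 ∧ pderiv i (pderiv j P) ≠ 0 := by
  classical
  rcases hchar with hml | ⟨i, hi2, hchar⟩
  · -- multilinear monomial: its support has `2^Δ` elements and is not pairwise compatible
    have hdeg : e.support.card = 2 ^ Δ := by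
      have h1 := hP.degree_eq_sum_deg_support he
      rw [h1, Finset.card_eq_sum_ones]
      refine Finset.sum_congr rfl fun i hi => ?_
      have h2 := hml i
      have h3 := Finsupp.mem_support_iff.1 hi
      omega
    have hnc : ¬ ∀ i ∈ e.support, ∀ j ∈ e.support, i ≠ j → pderiv i (pderiv j (anf K Δ)) ≠ 0 := by
      intro hc
      have h := (card_le_and_coeff_anf_ne_zero_of_compatible K Δ e.support hc).2 hdeg
      rw [← eq_sum_single_of_le_one e hml] at h
      exact h (notMem_support_iff.1 hne)
    push Not at hnc
    obtain ⟨i, hi, j, hj, hij, hzero⟩ := hnc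
    refine ⟨i, j, hzero, fun h0 => ?_⟩
    have hei : e i = 1 := le_antisymm (hml i) (Nat.one_le_iff_ne_zero.2 (Finsupp.mem_support_iff.1 hi))
    have hej : e j = 1 := le_antisymm (hml j) (Nat.one_le_iff_ne_zero.2 (Finsupp.mem_support_iff.1 hj))
    have hc := coeff_pderiv_pderiv_mixed hij P (e := e) hei.ge hej.ge
    rw [h0, coeff_zero, hei, hej, Nat.cast_one, one_mul, one_mul] at hc
    exact (mem_support_iff.1 he) hc.symm
  · -- a square: `∂_i² ANF = 0`, `∂_i² P ≠ 0`
    refine ⟨i, i, pderiv_pderiv_self_eq_zero_of_degreeOf_le_one i (degreeOf_anf_le_one K Δ i),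
      fun h0 => ?_⟩
    have hc := coeff_pderiv_pderiv_self i P hi2
    rw [h0, coeff_zero] at hc
    exact mul_ne_zero hchar (mem_support_iff.1 he) hc.symm

/-- **Lemma 5.13 core under a characteristic hypothesis**: if every exponent `1 ≤ m ≤ 2^Δ` is
nonzero in `K` (characteristic `0` or `> 2^Δ`), the separation holds for EVERY bad monomial.
[cite: MediniShpilka2021, Lemma 5.13 (arXiv p0029:L3-L13)] -/
theorem exists_pderiv_pderiv_anf_eq_zero_and_ne_zero_of_cast_ne_zero (Δ : ℕ)
    (hK : ∀ m : ℕ, 1 ≤ m → m ≤ 2 ^ Δ → (m : K) ≠ 0)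
    {P : MvPolynomial (Fin (4 ^ Δ)) K} (hP : P.IsHomogeneous (2 ^ Δ))
    {e : Fin (4 ^ Δ) →₀ ℕ} (he : e ∈ P.support) (hne : e ∉ (anf K Δ).support) :
    ∃ i j, pderiv i (pderiv j (anf K Δ)) = 0 ∧ pderiv i (pderiv j P) ≠ 0 := by
  classical
  refine exists_pderiv_pderiv_anf_eq_zero_and_ne_zero K Δ hP he hne ?_
  by_cases hml : ∀ i, e i ≤ 1
  · exact Or.inl hml
  · push Not at hml
    obtain ⟨i, hi⟩ := hml
    refine Or.inr ⟨i, hi, ?_⟩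
    have hle : e i ≤ 2 ^ Δ := by
      have h1 := hP.degree_eq_sum_deg_support he
      rw [h1]
      exact Finset.single_le_sum (fun _ _ => Nat.zero_le _)
        (Finsupp.mem_support_iff.2 (by omega))
    exact mul_ne_zero (hK _ (by omega) hle) (hK _ (by omega) (by omega))

/-- Characteristic `0` instance. [cite: MediniShpilka2021, Lemma 5.13 (arXiv p0029:L3-L13)] -/
theorem exists_pderiv_pderiv_anf_eq_zero_and_ne_zero_of_charZero [CharZero K] (Δ : ℕ)
    {P : MvPolynomial (Fin (4 ^ Δ)) K} (hP : P.IsHomogeneous (2 ^ Δ))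
    {e : Fin (4 ^ Δ) →₀ ℕ} (he : e ∈ P.support) (hne : e ∉ (anf K Δ).support) :
    ∃ i j, pderiv i (pderiv j (anf K Δ)) = 0 ∧ pderiv i (pderiv j P) ≠ 0 :=
  exists_pderiv_pderiv_anf_eq_zero_and_ne_zero_of_cast_ne_zero K Δ
    (fun m hm _ => by exact_mod_cast (by omega : m ≠ 0)) hP he hne

/-- Large positive characteristic instance (`char K > 2^Δ`). [cite: MediniShpilka2021, Lemma 5.13 (arXiv p0029:L3-L13)] -/
theorem exists_pderiv_pderiv_anf_eq_zero_and_ne_zero_of_lt_ringChar (Δ : ℕ)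
    (hp : 2 ^ Δ < ringChar K)
    {P : MvPolynomial (Fin (4 ^ Δ)) K} (hP : P.IsHomogeneous (2 ^ Δ))
    {e : Fin (4 ^ Δ) →₀ ℕ} (he : e ∈ P.support) (hne : e ∉ (anf K Δ).support) :
    ∃ i j, pderiv i (pderiv j (anf K Δ)) = 0 ∧ pderiv i (pderiv j P) ≠ 0 := by
  refine exists_pderiv_pderiv_anf_eq_zero_and_ne_zero_of_cast_ne_zero K Δ (fun m hm hmle h0 => ?_)
    hP he hne
  have hdvd := (ringChar.spec K m).1 h0
  have := Nat.le_of_dvd (by omega) hdvd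
  omega

/-- **Lemma 5.13 core for `ANF_Δ(My)`** (the lemma's own setting: "`g̃ = g(A_1⁻¹ x)`" is `ANF_Δ`
composed with a linear substitution): if `mon(ANF_Δ(My)) ⊄ mon(ANF_Δ(y))` then
`∃ i j, ∂_i∂_j ANF_Δ = 0 ∧ ∂_i∂_j(ANF_Δ(My)) ≠ 0`, under the exponent hypothesis `hK`
(characteristic `0` or `> 2^Δ`); the printed hypothesis "`mon ≠ mon`" is reduced to `⊄` by
Lemma 5.12 (lem:roanfMonInc), not proved here. [cite: MediniShpilka2021, Lemma 5.13 (arXiv p0029:L3-L13)] -/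
theorem exists_pderiv_pderiv_anf_separates_linSubst (Δ : ℕ)
    (hK : ∀ m : ℕ, 1 ≤ m → m ≤ 2 ^ Δ → (m : K) ≠ 0)
    (M : Matrix (Fin (4 ^ Δ)) (Fin (4 ^ Δ)) K)
    (hsub : ¬ (affSubst le_rfl M 0 (anf K Δ)).support ⊆ (anf K Δ).support) :
    ∃ i j, pderiv i (pderiv j (anf K Δ)) = 0 ∧
      pderiv i (pderiv j (affSubst le_rfl M 0 (anf K Δ))) ≠ 0 := by
  classical
  obtain ⟨e, he, hne⟩ := Finset.not_subset.1 hsub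
  have hP : (affSubst le_rfl M 0 (anf K Δ)).IsHomogeneous (2 ^ Δ) := by
    unfold affSubst
    have key := (isHomogeneous_anf K Δ).aeval
      (fun i : Fin (4 ^ Δ) => (∑ j : Fin (4 ^ Δ), C (M (Fin.castLE le_rfl i) j) * X j) +
        C ((0 : Fin (4 ^ Δ) → K) (Fin.castLE le_rfl i))) (n := 1) (fun i => ?_)
    · rwa [one_mul] at key
    · rw [Pi.zero_apply, C_0, add_zero]
      exact IsHomogeneous.sum _ _ _ fun j _ => (isHomogeneous_X _ _).C_mul _
  exact exists_pderiv_pderiv_anf_eq_zero_and_ne_zero_of_cast_ne_zero K Δ hK hP he hne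

end Separation

end MS2021

end Literature.Computability.AlgebraicComplexity

end
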